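import Mathlib
import HarnessLib
import Summits.QuantumAdvantage.QuantumAdvantage.Theorems.DigitDialB
import Literature.Computability.MetaComplexity.SmolenskyCorrelationRestrict

set_option linter.dupNamespace false
set_option autoImplicit false

/-!
# DigitDial (C) — LUCAS PERIODICITY: symmetric low-degree `𝔽_p`-strategies are weight-residue strategies; sharpness at `3 ∣ M`
(cell decomp-qadv, lens 4, g20)

Prop-definition-free tree twin of §4–§5 of the lens-4 g20 node `DigitDial`.
* §5 `wStrat_easyTable_perfect` — the coprimality hypothesis of `DigitDialB` is necessary: the weight-residue strategy mod `3`
  of `walkEasyThree` (`easyTable`) is PERFECT for every `n ≥ 1` and every charge.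
* §4 `altSum_eq_zero_of_mem_lowDeg` (the top alternating sum `Σ_u (−1)^{|u|} Q(u)` of a function of degree `< m` on `m` bits
  vanishes), `layerSum_eq_zero`, `sum_choose_primePow` (`Σ_j C(p^K, j) ψ(j) = ψ(0) + ψ(p^K)` in `ZMod p`),
  `symm_lowDeg_periodic` / `symm_factor`: a weight-SYMMETRIC `f` with `HasDegF p f d`, `d < p^K`, factors through
  `|u| mod p^K` — and the consequence `symmetric_card_win_le`: for every prime `p ≠ 3`, symmetric strategies of `𝔽_p`-degree
  `≤ (log₂ n)^C` win the u-walk game on `≤ (7/8)·2ⁿ` inputs for `n ≥ n₀(p, C)` (the symmetric sub-case of `WalkHardF p`).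
Nearest print analogue of §4: Kawałek–Weiß, STACS 2025, Thm 1 (periods of symmetric `MOD∘MOD∘AND` circuits).
0 sorry; axioms standard; no `instance`, no `notation`, no `native_decide`; no `def … : Prop`.
-/

noncomputable section

namespace Summit.QuantumAdvantage.QuantumAdvantage.Theorems.DigitDial

open Finset Summit.QuantumAdvantage.AdviceFreeQNC0 Literature.Computability.MetaComplexity
open TwistedTransfer ConstBells

/-! ## §5  The dial is sharp at `3 ∣ M`: the weight-residue strategy mod `3` is PERFECT (census K21(1), kernel) -/

section Sharp

variable {n : ℕ}

/-- `W_0 = 0`. [bookkeeping] -/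
private theorem wtPrefix_zero' (u : Fin n → Bool) : wtPrefix u 0 = 0 := by
  unfold wtPrefix
  simp

/-- `W_1 ≤ 1`. [bookkeeping] -/
private theorem wtPrefix_one_le' (u : Fin n → Bool) : wtPrefix u 1 ≤ 1 := by
  unfold wtPrefix
  refine le_trans (Finset.card_le_card (fun i hi => ?_ : _ ⊆ univ.filter fun i : Fin n => i.val < 1)) ?_
  · rw [mem_filter] at hi ⊢
    exact ⟨hi.1, hi.2.1⟩
  · refine Finset.card_le_one.2 fun a ha b hb => ?_
    rw [mem_filter] at ha hb
    exact Fin.ext (by omega)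

/-- The weight residue is the weight: `(|u| mod M).val = wt u % M`. [bookkeeping] -/
theorem wres_val (M : ℕ) [NeZero M] (u : Fin n → Bool) : (wres M u).val = wt u % M := by
  unfold wres wt
  rw [Finset.sum_boole, ZMod.val_natCast]

/-- The mod-`3` weight table of `walkEasyThree`: cut `0` fires iff `c + |u| ≢ 0`, else cut `1` fires. -/
def easyTable (c n : ℕ) : Fin (n + 1) → ZMod 3 → Bool := fun g m =>
  if g.val = 0 then decide ((c + m.val) % 3 ≠ 0) else if g.val = 1 then decide ((c + m.val) % 3 = 0) else false

/-- **Sharpness at `M = 3`**: the weight-residue strategy `easyTable` wins on EVERY input (`n ≥ 1`, every charge) — the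
coprimality hypothesis `3 ∤ M` of `card_win_wStrat_le` cannot be dropped (this is `OddPrimeWitnesses.walkEasyThree`'s
strategy, an `𝔽₃`-degree-`2` SYMMETRIC strategy, and instrument K21(1) of the census). -/
theorem wStrat_easyTable_perfect (c n : ℕ) (hn : 1 ≤ n) (u : Fin n → Bool) :
    ringWinU c (wStrat (easyTable c n)) u = true := by
  have hval : (c + (wres 3 u).val) % 3 = (c + wt u) % 3 := by rw [wres_val]; omega
  unfold ringWinU wStrat easyTable
  rw [decide_eq_true_eq]
  simp_rw [hval]
  set g₀ : Fin (n + 1) := ⟨if (c + wt u) % 3 ≠ 0 then 0 else 1, by split_ifs <;> omega⟩ with hg₀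
  have hset : (univ.filter fun g : Fin (n + 1) =>
      (if g.val = 0 then decide ((c + wt u) % 3 ≠ 0)
        else if g.val = 1 then decide ((c + wt u) % 3 = 0) else false) = true ∧
        (c + g.val + walkExp u g.val) % 3 ≠ 0) = {g₀} := by
    ext g
    simp only [mem_filter, mem_univ, true_and, mem_singleton]
    have hW1 := wtPrefix_one_le' u
    constructor
    · rintro ⟨hy, _⟩
      apply Fin.ext
      rw [hg₀]
      by_cases h0 : g.val = 0
      · simp only [h0, if_true, decide_eq_true_eq] at hy
        simp [h0, hy]
      · by_cases h1 : g.val = 1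
        · simp [h1] at hy
          simp [h1, hy]
        · simp [h0, h1] at hy
    · intro hg
      subst hg
      by_cases h : (c + wt u) % 3 ≠ 0
      · have hv : g₀.val = 0 := by rw [hg₀]; simp [h]
        refine ⟨by simp [hv, h], ?_⟩
        rw [hv, walkExp, wtPrefix_zero']
        simpa using h
      · have hv : g₀.val = 1 := by rw [hg₀]; simp [h]
        rw [not_not] at h
        refine ⟨by simp [hv, h], ?_⟩
        rw [hv, walkExp]
        omega
  rw [hset, card_singleton]

end Sharp

/-! ## §4  Lucas periodicity: a SYMMETRIC `𝔽_p`-strategy of degree `< p^K` IS a weight-residue strategy mod `p^K`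

For `P ∈ lowDeg 𝔽 m D` with `D < m` the top alternating sum `Σ_u (-1)^{|u|} P(u)` vanishes (it kills every
monomial `x_S`, `S ≠ univ`).  Applied on a `q = p^K`-dimensional sub-cube `u ↦ (u, 1^w 0^{t-w})` of a
SYMMETRIC `P` of degree `d < q` it gives `Σ_j (-1)^j C(q,j) G(w+j) = 0` for the layer values `G`; by Lucas
(`p ∣ C(p^K, j)`, `0 < j < p^K`) this is `G(w) = G(w + q)`: the layer values are `q`-PERIODIC, i.e. `P(u)` depends
only on `|u| mod p^K` — the symmetric low-degree class is INSIDE the weight-residue class (`symm_factor`). -/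

section Lucas

open Smolensky

variable {F : Type*} [Field F]

/-- `|x|` as a sum of bits. [bookkeeping] -/
theorem wt_eq_sum {m : ℕ} (x : Fin m → Bool) : wt x = ∑ i, if x i then 1 else 0 := by
  unfold wt
  rw [Finset.card_filter]

/-- `Π_i sgn(xᵢ) = (-1)^{|x|}`. [bookkeeping] -/
theorem prod_sgn_eq_pow {m : ℕ} (x : Fin m → Bool) : (∏ i, (if x i then (-1 : F) else 1)) = (-1) ^ wt x := by
  rw [wt_eq_sum x, ← Finset.prod_pow_eq_pow_sum]
  refine Finset.prod_congr rfl fun i _ => ?_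
  by_cases h : x i = true <;> simp [h]

/-- **(A)** the top alternating sum kills a proper monomial: `Σ_u (Π_i sgn uᵢ) · x_S(u) = 0` for `|S| < m`
(factorise over coordinates; the factor at a coordinate outside `S` is `(-1) + 1 = 0`). -/
theorem altSum_mono_eq_zero {m : ℕ} (S : Finset (Fin m)) (hS : S.card < m) :
    ∑ u : Fin m → Bool, (∏ i, (if u i then (-1 : F) else 1)) * mono F S u = 0 := by
  classical
  obtain ⟨j₀, -, hj₀⟩ : ∃ j, j ∈ (univ : Finset (Fin m)) ∧ j ∉ S :=
    Finset.exists_mem_notMem_of_card_lt_card (by rw [Finset.card_univ, Fintype.card_fin]; exact hS)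
  let φ : Fin m → Bool → F := fun i b =>
    (if b then (-1 : F) else 1) * (if i ∈ S then (if b then (1 : F) else 0) else 1)
  have hterm : ∀ u : Fin m → Bool, (∏ i, (if u i then (-1 : F) else 1)) * mono F S u = ∏ i, φ i (u i) := by
    intro u
    have hmono : mono F S u = ∏ i, (if i ∈ S then (if u i then (1 : F) else 0) else 1) := by
      rw [Finset.prod_ite_mem, Finset.univ_inter]
      rfl
    rw [hmono, ← Finset.prod_mul_distrib]
  have key : (∏ i, ∑ b : Bool, φ i b) = ∑ x : Fin m → Bool, ∏ i, φ i (x i) := Fintype.prod_sum φ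
  rw [Finset.sum_congr rfl fun u _ => hterm u, ← key]
  refine Finset.prod_eq_zero (Finset.mem_univ j₀) ?_
  rw [Fintype.sum_bool]
  simp [φ, hj₀]

/-- **(A′)** … hence kills all of `lowDeg F m D`, `D < m`. -/
theorem altSum_eq_zero_of_mem_lowDeg {m D : ℕ} (hD : D < m) {Q : CubeFn F m} (hQ : Q ∈ lowDeg F m D) :
    ∑ u : Fin m → Bool, (∏ i, (if u i then (-1 : F) else 1)) * Q u = 0 := by
  rw [lowDeg_eq_span] at hQ
  refine Submodule.span_induction (p := fun Q _ => ∑ u : Fin m → Bool, (∏ i, (if u i then (-1 : F) else 1)) * Q u = 0)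
    ?_ ?_ ?_ ?_ hQ
  · rintro _ ⟨⟨S, hS⟩, rfl⟩
    exact altSum_mono_eq_zero S (lt_of_le_of_lt hS hD)
  · simp
  · intro x y _ _ hx hy
    simp only [Pi.add_apply, mul_add, Finset.sum_add_distrib, hx, hy, add_zero]
  · intro a x _ hx
    simp only [Pi.smul_apply, smul_eq_mul]
    simp_rw [mul_left_comm _ a, ← Finset.mul_sum, hx, mul_zero]

/-- `|append u a| = |u| + |a|`. [bookkeeping] -/
theorem wt_append {q t : ℕ} (u : Fin q → Bool) (a : Fin t → Bool) : wt (Fin.append u a) = wt u + wt a := by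
  simp_rw [wt_eq_sum]
  rw [Fin.sum_univ_add]
  simp [Fin.append_left, Fin.append_right]

/-- The pattern `1^w 0^{t-w}`. -/
def onesV (t w : ℕ) : Fin t → Bool := fun j => decide (j.val < w)

/-- `|1^w 0^{t-w}| = w` for `w ≤ t`. [bookkeeping] -/
theorem wt_onesV {t w : ℕ} (hw : w ≤ t) : wt (onesV t w) = w := by
  unfold wt onesV
  rcases Nat.lt_or_ge w t with hlt | hge
  · have : (univ.filter fun j : Fin t => decide (j.val < w) = true) = Finset.Iio (⟨w, hlt⟩ : Fin t) := by
      ext j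
      simp [Fin.lt_def]
    rw [this, Fin.card_Iio]
  · have hw' : w = t := le_antisymm hw hge
    subst hw'
    have : (univ.filter fun j : Fin w => decide (j.val < w) = true) = univ := by
      ext j
      simp
    rw [this, Finset.card_univ, Fintype.card_fin]

/-- `|u| ≤ m`. [bookkeeping] -/
theorem wt_le {m : ℕ} (u : Fin m → Bool) : wt u ≤ m := by
  unfold wt
  exact (Finset.card_filter_le _ _).trans (by simp)

/-- **(B)** the layer identity on a `q`-dimensional sub-cube: if `P ∈ lowDeg (q+t) d`, `d < q`, has the values
`P(u, 1^w 0^{t-w}) = G(|u| + w)`, then `Σ_{j ≤ q} C(q,j) (-1)^j G(j + w) = 0`. -/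
theorem layerSum_eq_zero {q t d : ℕ} (hdq : d < q) {P : CubeFn F (q + t)} (hP : P ∈ lowDeg F (q + t) d)
    (G : ℕ → F) (w : ℕ) (hG : ∀ u : Fin q → Bool, P (Fin.append u (onesV t w)) = G (wt u + w)) :
    ∑ j ∈ range (q + 1), ((q.choose j : ℕ) : F) * ((-1) ^ j * G (j + w)) = 0 := by
  have h0 := altSum_eq_zero_of_mem_lowDeg hdq (comp_append_mem_lowDeg hP (onesV t w))
  simp_rw [hG, prod_sgn_eq_pow] at h0
  rw [← Finset.sum_fiberwise_of_maps_to' (s := (univ : Finset (Fin q → Bool))) (t := range (q + 1)) (g := wt)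
    (fun u _ => Finset.mem_range.2 (Nat.lt_succ_of_le (wt_le u))) (fun j => (-1 : F) ^ j * G (j + w))] at h0
  rw [← h0]
  refine Finset.sum_congr rfl fun j _ => ?_
  rw [Finset.sum_const, nsmul_eq_mul]
  congr 2
  exact (Hegedus.card_layer q j).symm

/-- **(C)** Lucas: `C(p^K, j) = 0` in `𝔽_p` for `0 < j < p^K`, so `Σ_{j ≤ p^K} C(p^K, j) ψ(j) = ψ(0) + ψ(p^K)`.
(Mathlib: `Nat.Prime.dvd_choose_pow`; landing edit: the lens's bracketed cite tag named a Mathlib lemma, not a references.bib key, and is rephrased here) -/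
theorem sum_choose_primePow {p : ℕ} [hp : Fact p.Prime] (K : ℕ) (ψ : ℕ → ZMod p) :
    ∑ j ∈ range (p ^ K + 1), (((p ^ K).choose j : ℕ) : ZMod p) * ψ j = ψ 0 + ψ (p ^ K) := by
  obtain ⟨q', hq'⟩ : ∃ q', p ^ K = q' + 1 := ⟨p ^ K - 1, (Nat.sub_add_cancel (Nat.one_le_pow _ _ hp.out.pos)).symm⟩
  rw [hq', Finset.sum_range_succ, Finset.sum_range_succ', Nat.choose_self, Nat.choose_zero_right, Nat.cast_one,
    one_mul, one_mul]
  have hmid : ∑ j ∈ range q', (((q' + 1).choose (j + 1) : ℕ) : ZMod p) * ψ (j + 1) = 0 := by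
    refine Finset.sum_eq_zero fun j hj => ?_
    have hj' := Finset.mem_range.1 hj
    have hdvd : p ∣ (q' + 1).choose (j + 1) := by
      rw [← hq']
      exact hp.out.dvd_choose_pow (by omega) (by omega)
    rw [(ZMod.natCast_eq_zero_iff _ _).2 hdvd, zero_mul]
  rw [hmid, zero_add, add_comm]

/-- `-(-1)^{p^K} = 1` in `𝔽_p` (for `p = 2` because `-1 = 1`, for odd `p` because `p^K` is odd). -/
theorem neg_neg_one_pow_primePow {p : ℕ} [hp : Fact p.Prime] (K : ℕ) : -((-1 : ZMod p) ^ (p ^ K)) = 1 := by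
  rcases hp.out.eq_two_or_odd' with rfl | hodd
  · have h1 : (-1 : ZMod 2) = 1 := ZMod.neg_eq_self_mod_two 1
    rw [h1, one_pow, h1]
  · rw [(hodd.pow).neg_one_pow, neg_neg]

/-- **Lucas periodicity** (the heart of §4): a weight-symmetric `P ∈ lowDeg 𝔽_p n d` with `d < p^K` depends only
on `|u| mod p^K`. -/
theorem symm_lowDeg_periodic {p : ℕ} [hp : Fact p.Prime] {n d K : ℕ} (hd : d < p ^ K)
    {P : CubeFn (ZMod p) n} (hP : P ∈ lowDeg (ZMod p) n d)
    (hsymm : ∀ u v : Fin n → Bool, wt u = wt v → P u = P v)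
    (u v : Fin n → Bool) (huv : wt u % p ^ K = wt v % p ^ K) : P u = P v := by
  by_cases hqn : p ^ K ≤ n
  · obtain ⟨t, rfl⟩ : ∃ t, n = p ^ K + t := ⟨n - p ^ K, by omega⟩
    -- layer values
    set G : ℕ → ZMod p := fun w => P (onesV (p ^ K + t) w) with hGdef
    have hPG : ∀ x : Fin (p ^ K + t) → Bool, P x = G (wt x) := fun x =>
      hsymm x _ (wt_onesV (wt_le x)).symm
    -- one period: `G (w + q) = G w` for `w ≤ t`
    have hper : ∀ w, w ≤ t → G (w + p ^ K) = G w := by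
      intro w hw
      have hlayer := layerSum_eq_zero (F := ZMod p) hd hP G w (fun x => by
        rw [hPG, wt_append, wt_onesV hw])
      rw [sum_choose_primePow K (fun j => (-1 : ZMod p) ^ j * G (j + w))] at hlayer
      simp only [pow_zero, one_mul, zero_add] at hlayer
      -- `G w + (-1)^q G (q + w) = 0`
      have hsq : ((-1 : ZMod p) ^ (p ^ K)) ^ 2 = 1 := by rw [← pow_mul, mul_comm, pow_mul, neg_one_sq, one_pow]
      have := congrArg (fun z => (-1 : ZMod p) ^ (p ^ K) * z) hlayer
      simp only [mul_add, ← mul_assoc, mul_zero] at this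
      rw [← sq, hsq, one_mul] at this
      -- `G (q + w) = -(-1)^q * G w = G w`
      have hG' : G (p ^ K + w) = -((-1 : ZMod p) ^ (p ^ K)) * G w := by
        rw [neg_mul]
        exact eq_neg_of_add_eq_zero_right this
      rw [add_comm w, hG', neg_neg_one_pow_primePow, one_mul]
    -- all periods: `G w = G (w % q)` for `w ≤ q + t`
    have hmod : ∀ w, w ≤ p ^ K + t → G w = G (w % p ^ K) := by
      intro w
      induction w using Nat.strong_induction_on with
      | _ w ih =>
        intro hw
        rcases Nat.lt_or_ge w (p ^ K) with hlt | hge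
        · rw [Nat.mod_eq_of_lt hlt]
        · have hq1 : 1 ≤ p ^ K := Nat.one_le_pow _ _ hp.out.pos
          have h1 : G w = G (w - p ^ K) := by
            conv_lhs => rw [← Nat.sub_add_cancel hge]
            exact hper _ (by omega)
          rw [h1, ih (w - p ^ K) (by omega) (by omega)]
          conv_rhs => rw [← Nat.sub_add_cancel hge, Nat.add_mod_right]
    rw [hPG u, hPG v, hmod _ (wt_le u), hmod _ (wt_le v), huv]
  · -- `q > n`: the residues are the weights
    rw [Nat.mod_eq_of_lt (lt_of_le_of_lt (wt_le u) (by omega)),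
      Nat.mod_eq_of_lt (lt_of_le_of_lt (wt_le v) (by omega))] at huv
    exact hsymm u v huv

/-- **`symm_factor`** — a SYMMETRIC Boolean function of `𝔽_p`-degree `d < p^K` factors through the weight
residue mod `p^K`: it is a weight-residue strategy `u ↦ h(|u| mod p^K)`. -/
theorem symm_factor {p : ℕ} [hp : Fact p.Prime] {n d K : ℕ} (hd : d < p ^ K) {f : (Fin n → Bool) → Bool}
    (hf : ∀ u v : Fin n → Bool, wt u = wt v → f u = f v) (hdeg : HasDegF p f d) :
    ∃ h : ZMod (p ^ K) → Bool, ∀ u, f u = h (wres (p ^ K) u) := by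
  haveI : NeZero (p ^ K) := ⟨pow_ne_zero _ hp.out.ne_zero⟩
  refine ⟨fun m => f (onesV n m.val), fun u => ?_⟩
  have hsymmP : ∀ u v : Fin n → Bool, wt u = wt v →
      (fun x => if f x then (1 : ZMod p) else 0) u = (fun x => if f x then (1 : ZMod p) else 0) v := by
    intro u v huv
    simp only [hf u v huv]
  have hw : wt (onesV n ((wres (p ^ K) u).val)) = wt u % p ^ K := by
    rw [wres_val]
    exact wt_onesV ((Nat.mod_le _ _).trans (wt_le u))
  have hP := symm_lowDeg_periodic hd hdeg hsymmP u (onesV n ((wres (p ^ K) u).val))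
    (by rw [hw, Nat.mod_mod])
  show f u = f (onesV n ((wres (p ^ K) u).val))
  by_cases hfu : f u = true <;> by_cases hfv : f (onesV n ((wres (p ^ K) u).val)) = true <;>
    simp_all

/-- **SYMMETRIC low-degree strategies lose the u-walk game** (the symmetric sub-case of `WalkHardF`, in its own
currency, for EVERY prime `p ≠ 3`, `θ = 7/8`): for every `C`, for `n ≥ n₀(p, C)`, every charge and every strategy all of
whose output bits are weight-SYMMETRIC Boolean functions of `𝔽_p`-degree `≤ (log₂ n)^C` wins on at most `(7/8)·2ⁿ` inputs.
(`p = 3` is excluded by `wStrat_easyTable_perfect`; `p = 2` is allowed.)  Proof: Lucas periodicity (`symm_factor` with `p^K`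
the least power of `p` above the degree, so `p^K ≤ p·(log₂ n)^C ≤ (log₂ n)^{C+1}` once `log₂ n ≥ p`) +
`card_win_wStrat_le_polylog`. -/
theorem symmetric_card_win_le (p : ℕ) [Fact p.Prime] (hp3 : p ≠ 3) (C : ℕ) : ∃ n₀ : ℕ, ∀ n ≥ n₀, ∀ c : ℕ,
    ∀ y : Fin (n + 1) → (Fin n → Bool) → Bool, (∀ g, ∀ u v : Fin n → Bool, wt u = wt v → y g u = y g v) →
      (∀ g, HasDegF p (y g) ((Nat.log 2 n) ^ C)) →
        ((univ.filter fun u : Fin n → Bool => ringWinU c y u = true).card : ℝ) ≤ (7 / 8) * (2 : ℝ) ^ n := by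
  have hp : Fact p.Prime := inferInstance
  obtain ⟨n₁, hn₁⟩ := card_win_wStrat_le_polylog (C + 1)
  refine ⟨max n₁ (2 ^ p), fun n hn c y hys hyd => ?_⟩
  have hn1 : n₁ ≤ n := le_trans (le_max_left _ _) hn
  have hn2 : 2 ^ p ≤ n := le_trans (le_max_right _ _) hn
  have hp2 : 2 ≤ p := hp.out.two_le
  -- the modulus `M = p^K`, `K = log_p d + 1`, `d = (log₂ n)^C`
  set d : ℕ := (Nat.log 2 n) ^ C with hd
  have hL : p ≤ Nat.log 2 n := Nat.le_log_of_pow_le (by norm_num) hn2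
  have hd1 : 1 ≤ d := Nat.one_le_pow _ _ (by omega)
  set K : ℕ := Nat.log p d + 1 with hK
  have hdK : d < p ^ K := Nat.lt_pow_succ_log_self hp.out.one_lt d
  have hKle : p ^ K ≤ (Nat.log 2 n) ^ (C + 1) := by
    rw [hK, pow_succ, pow_succ]
    exact Nat.mul_le_mul (Nat.pow_log_le_self p (by omega)) hL
  haveI : NeZero (p ^ K) := ⟨pow_ne_zero _ hp.out.ne_zero⟩
  have hcop : (p ^ K).Coprime 3 :=
    Nat.Coprime.pow_left _ ((Nat.coprime_primes hp.out Nat.prime_three).2 hp3)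
  -- every output bit factors through the weight residue mod `p^K`
  choose h hh using fun g => symm_factor hdK (hys g) (hyd g)
  have hy : y = wStrat h := by
    funext g u
    exact hh g u
  rw [hy]
  exact hn₁ n hn1 c (p ^ K) hcop hKle h

end Lucas

end Summit.QuantumAdvantage.QuantumAdvantage.Theorems.DigitDial
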